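import Summits.FinalStateConjecture.FinalStateConjecture.Theorems.PhotonSphereChannelsChannelsResolveTameDevelopmentsRTrappedSetOmegaLimits
import Summits.FinalStateConjecture.FinalStateConjecture.Theorems.PhotonSphereChannelsTameHullDefs
import Summits.FinalStateConjecture.FinalStateConjecture.Theorems.PhotonSphereChannelsChannelsResolveTameDevelopmentsRTrappedSetMinkowskiLimit
import Summits.FinalStateConjecture.FinalStateConjecture.Theorems.UniversalWitnessFamily.Negative.MinkowskiSettled
import Literature.Geometry.Lorentzian.TimeSeparationPrefix
import Literature.Geometry.Lorentzian.TimeSeparationDuality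
import Literature.Geometry.Lorentzian.MinkowskiGlobalHyperbolicity
import HarnessLib

/-!
# Crux `ChannelsResolveTameDevelopmentsR` (stmt-FinalStateConjecture-14075), line
# `trapped-set-observability-analyticity` — stub `stub_tameEndgame` (S7): audit lemmas

S7 (the tame endgame; verbatim S7 of line `limit-bifurcation-sphere-hawking-collar` of crux
stmt-10046) says: if along every ESCAPING sequence of outer base points of a tame MGHD with
complete `𝓘⁺` a `TameEternalLimit` arises which is a Kerr black hole or flat, then the honest
exhaustive `FinalStateDecomposition` exists.  This file lands the provable pieces of its audit,
over the landed vocabulary `Theorems.TrappedSet` (`PhotonSphereChannelsTameEternalLimitDefs`):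

* §1 the missing half of O'Neill's reverse triangle inequality in the tree: the time separation
  is monotone in its SECOND argument (`lorentzDist_le_lorentzDist_of_mem_causalFuture_right`,
  time dual of `TimeSeparationPrefix`);
* §2 (audit A2, escape notions) an `IsEscaping` sequence (time separation from `ι X` → `∞`)
  eventually leaves every set — and the causal past of every set — on which the time separation
  from `ι X` is bounded (`IsEscaping.eventually_not_mem_causalPast`, registered sub-goal
  `stub_isEscapingLeavesBoundedPasts`); hence, GRANTED finiteness of the time separation on
  compact sets (O'Neill 14.21, not in the tree), it is future-escaping in the sense of the
  sibling line's `TameHull.IsFutureEscaping` (`isFutureEscaping_of_isEscaping`; the converse is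
  false: points of `ℝ⁴₁` marching to `i⁰` at time `1`);
* §3 (audit A3) a `LocalSubconvergence` datum from a sequence of GLOBAL ISOMETRIES: every
  sequence of pointed Minkowski spaces `(ℝ⁴₁, pₙ)` converges with far charts to `(ℝ⁴₁, 0)`
  through the translations `y ↦ pₙ + y`
  (`subconvergesLocallyWithFarChartsTo_minkowski_translate`);
* §4 S7 AT THE MODEL POINT (registered sub-goal `stub_tameEndgameMinkowskiModel`): on the
  Minkowski development of `(ℝ³, δ, 0)` the antecedent of S7 holds along EVERY sequence (the flat
  Minkowski `TameEternalLimit` arises) and the consequent holds (the tree's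
  `UniversalWitnessFamily.Negative.settledIn_minkowski`): S7 is neither vacuous by antecedent
  nor cheap by consequent there.
-/

set_option linter.dupNamespace false

noncomputable section

namespace Summit.FinalStateConjecture.FinalStateConjecture.Theorems.TrappedSet

open Literature.Geometry.Lorentzian
open scoped Manifold ContDiff Topology ENNReal NNReal
open Filter Set Function TopologicalSpace

/-! ## §1 Appending a causal curve: the time separation is monotone in its second argument -/

section Suffix

variable {E : Type*} [NormedAddCommGroup E] [NormedSpace ℝ E] {H : Type*} [TopologicalSpace H]
  {I : ModelWithCorners ℝ E H} {n : ℕ∞ω} {M : Type*} [TopologicalSpace M] [ChartedSpace H M]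
  [IsManifold I ∞ M] [BoundarylessManifold I M] {g : LorentzianMetric I n M} {τ : TimeOrientation g}

/-- **Monotonicity of the time separation under `≤` in the second argument**: if `r ∈ J⁺(q)`
then `d(p, q) ≤ d(p, r)` — the half of O'Neill's reverse triangle inequality
`τ(p, q) + τ(q, r) ≤ τ(p, r)` that drops `τ(q, r)`; the time dual
(`lorentzDist_reverse`) of the tree's prefix half `lorentzDist_le_lorentzDist_of_mem_causalFuture`.
[cite: ONeillSemiRiemannian1983, Ch. 14, Lemma 14.16 (2) (p. 409)] -/
theorem lorentzDist_le_lorentzDist_of_mem_causalFuture_right (hn : 1 ≤ n) (p : M) {q r : M}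
    (hr : r ∈ g.causalFuture τ {q}) : g.lorentzDist τ p q ≤ g.lorentzDist τ p r := by
  have hq : q ∈ g.causalFuture τ.reverse {r} :=
    LorentzianMetric.mem_causalPast_singleton_iff.2 hr
  have h := LorentzianMetric.lorentzDist_le_lorentzDist_of_mem_causalFuture (τ := τ.reverse) hn hq p
  rwa [LorentzianMetric.lorentzDist_reverse, LorentzianMetric.lorentzDist_reverse] at h

end Suffix

/-! ## §2 Escaping sequences leave every set of bounded time separation from `ι X` -/

section Development

variable {X : Type} [TopologicalSpace X] [ChartedSpace Literature.Geometry.Lorentzian.E3 X]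
  [IsManifold (modelWithCornersSelf ℝ Literature.Geometry.Lorentzian.E3) ((⊤ : ℕ∞) : WithTop ℕ∞) X]
  [ConnectedSpace X]
  {D : Literature.Geometry.Lorentzian.InitialDataSet (modelWithCornersSelf ℝ Literature.Geometry.Lorentzian.E3) X}

/-- **Escaping is stable under reparametrisations tending to `∞`** (in particular under
subsequences, `IsEscaping.comp_strictMono`). [folklore] -/
theorem IsEscaping.comp_tendsto {𝒟 : CauchyDevelopment D} {p : ℕ → 𝒟.carrier}
    (h : IsEscaping 𝒟 p) {ρ : ℕ → ℕ} (hρ : Tendsto ρ atTop atTop) : IsEscaping 𝒟 (p ∘ ρ) :=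
  fun T ↦ hρ.eventually (h T)

/-- **An escaping sequence eventually leaves every set on which the time separation from the
Cauchy hypersurface is bounded**: if `d(ι x, q) ≤ T` for all `x ∈ X`, `q ∈ S`, then eventually
`p n ∉ S`. [folklore] -/
theorem IsEscaping.eventually_not_mem_of_lorentzDist_le {𝒟 : CauchyDevelopment D}
    {p : ℕ → 𝒟.carrier} (h : IsEscaping 𝒟 p) {S : Set 𝒟.carrier} {T : ℝ}
    (hS : ∀ x : X, ∀ q ∈ S, 𝒟.toSpacetime.lorentzDist (𝒟.embed x) q ≤ ENNReal.ofReal T) :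
    ∀ᶠ n in atTop, p n ∉ S := by
  filter_upwards [h (max T 0 + 1)] with n hn hpn
  obtain ⟨x, hx⟩ := hn
  have h1 : ENNReal.ofReal (max T 0 + 1) ≤ ENNReal.ofReal (max T 0) :=
    (hx.trans (hS x _ hpn)).trans (ENNReal.ofReal_le_ofReal (le_max_left T 0))
  rw [ENNReal.ofReal_le_ofReal_iff (le_max_right T 0)] at h1
  linarith

/-- **An escaping sequence eventually leaves the causal past of every set on which the time
separation from `ι X` is bounded** (e.g. every compact set, once O'Neill's Lemma 14.21 —
finiteness and continuity of the time separation on globally hyperbolic sets — is available):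
for `q ≤ k`, `d(ι x, q) ≤ d(ι x, k) ≤ T` (`lorentzDist_le_lorentzDist_of_mem_causalFuture_right`).
[cite: ONeillSemiRiemannian1983, Ch. 14, Lemma 14.16 (2) (p. 409)] -/
theorem IsEscaping.eventually_not_mem_causalPast {𝒟 : CauchyDevelopment D}
    {p : ℕ → 𝒟.carrier} (h : IsEscaping 𝒟 p) {K : Set 𝒟.carrier} {T : ℝ}
    (hK : ∀ x : X, ∀ k ∈ K, 𝒟.toSpacetime.lorentzDist (𝒟.embed x) k ≤ ENNReal.ofReal T) :
    ∀ᶠ n in atTop, p n ∉ 𝒟.metric.causalPast 𝒟.timeOrientation K := by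
  refine h.eventually_not_mem_of_lorentzDist_le (T := T) fun x q hq ↦ ?_
  rw [LorentzianMetric.causalPast, LorentzianMetric.causalFuture_eq_biUnion] at hq
  obtain ⟨k, hk, hqk⟩ := mem_iUnion₂.1 hq
  have hkq : k ∈ 𝒟.metric.causalFuture 𝒟.timeOrientation {q} :=
    LorentzianMetric.mem_causalPast_singleton_iff.1 hqk
  have hn1 : (1 : ℕ∞ω) ≤ (∞ : ℕ∞ω) := WithTop.coe_le_coe.mpr le_top
  exact (lorentzDist_le_lorentzDist_of_mem_causalFuture_right hn1 (𝒟.embed x) hkq).trans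
    (hK x k hk)

/-- **Bridge to the sibling line's escape notion** (`TameHull.IsFutureEscaping`, line
`tame-hull-exact-rigidity-only` of crux stmt-10046: "eventually leaves `J⁻(K)` for every compact
`K`"): GRANTED that the time separation from `ι X` is bounded on every compact set (true in a
globally hyperbolic development, O'Neill 1983, Ch. 14, Lemma 14.21 with Lemma 14.22 — not in the
tree), an escaping sequence of outer points is future-escaping.  The converse fails (points of
Minkowski space marching to spatial infinity at time `1` leave every `J⁻(K)` at time separation
`1` from `{x⁰ = 0}`). [cite: ONeillSemiRiemannian1983, Ch. 14, Lemma 14.21] -/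
theorem isFutureEscaping_of_isEscaping {X : Type} [TopologicalSpace X]
    [ChartedSpace Literature.Geometry.Lorentzian.E3 X]
    [IsManifold (modelWithCornersSelf ℝ Literature.Geometry.Lorentzian.E3) ((⊤ : ℕ∞) : WithTop ℕ∞) X]
    [T2Space X] [SecondCountableTopology X] [ConnectedSpace X]
    {D : Literature.Geometry.Lorentzian.InitialDataSet (modelWithCornersSelf ℝ Literature.Geometry.Lorentzian.E3) X}
    (𝒟 : VacuumCauchyDevelopment D) [𝒟.metric.HasLeviCivita] {p : ℕ → 𝒟.carrier}
    (hout : ∀ n, p n ∈ outerRegion 𝒟.toCauchyDevelopment) (h : IsEscaping 𝒟.toCauchyDevelopment p)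
    (hfin : ∀ K : Set 𝒟.carrier, IsCompact K → ∃ T : ℝ, ∀ x : X, ∀ k ∈ K,
      𝒟.toSpacetime.lorentzDist (𝒟.embed x) k ≤ ENNReal.ofReal T) :
    TameHull.IsFutureEscaping 𝒟 p :=
  ⟨hout, fun K hK ↦ (hfin K hK).elim fun _ hT ↦ h.eventually_not_mem_causalPast hT⟩

/-- Registered sub-goal `stub_isEscapingLeavesBoundedPasts` of `stub_tameEndgame` (S7), audit
(A2): an escaping sequence eventually leaves the causal past of every set on which the time
separation from `ι X` is bounded (`IsEscaping.eventually_not_mem_causalPast`). [folklore] -/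
theorem stub_isEscapingLeavesBoundedPasts :
    ∀ (X : Type) [TopologicalSpace X] [ChartedSpace Literature.Geometry.Lorentzian.E3 X] [IsManifold (modelWithCornersSelf ℝ Literature.Geometry.Lorentzian.E3) ((⊤ : ℕ∞) : WithTop ℕ∞) X] [ConnectedSpace X] (D : Literature.Geometry.Lorentzian.InitialDataSet (modelWithCornersSelf ℝ Literature.Geometry.Lorentzian.E3) X) (𝒟 : Literature.Geometry.Lorentzian.CauchyDevelopment D) (p : ℕ → 𝒟.carrier), IsEscaping 𝒟 p → ∀ (K : Set 𝒟.carrier) (T : ℝ), (∀ x : X, ∀ k ∈ K, 𝒟.toSpacetime.lorentzDist (𝒟.embed x) k ≤ ENNReal.ofReal T) → ∀ᶠ n in Filter.atTop, p n ∉ 𝒟.metric.causalPast 𝒟.timeOrientation K := by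
  intro X _ _ _ _ D 𝒟 p h K T hK
  exact h.eventually_not_mem_causalPast hK

end Development

/-! ## §3 Translates of Minkowski space subconverge, with far charts, to Minkowski space -/

section MinkowskiTranslates

/-- The differential of a translate `T_c ∘ ψ`, `T_c = (c + ·)`, of a map `ψ : E4 → E4` is the
differential of `ψ` (chain rule with `dT_c = id`; at points where `ψ` is not differentiable
neither is `T_c ∘ ψ = T_{-c}⁻¹ ∘ ψ`, and both junk differentials vanish). [folklore] -/
theorem mfderiv_translate_comp (c : E4) (ψ : E4 → E4) (y : E4) :
    mfderiv 𝓘(ℝ, E4) 𝓘(ℝ, E4) ((fun z : E4 ↦ c + z) ∘ ψ) y = mfderiv 𝓘(ℝ, E4) 𝓘(ℝ, E4) ψ y := by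
  have hT : ∀ (a z : E4), HasMFDerivAt 𝓘(ℝ, E4) 𝓘(ℝ, E4) (fun z : E4 ↦ a + z) z
      (ContinuousLinearMap.id ℝ E4) := fun a z ↦ ((hasFDerivAt_id z).const_add a).hasMFDerivAt
  by_cases hψ : MDifferentiableAt 𝓘(ℝ, E4) 𝓘(ℝ, E4) ψ y
  · rw [((hT c (ψ y)).comp y hψ.hasMFDerivAt).mfderiv]
    exact ContinuousLinearMap.id_comp _
  · have hψ' : ¬ MDifferentiableAt 𝓘(ℝ, E4) 𝓘(ℝ, E4) ((fun z : E4 ↦ c + z) ∘ ψ) y := by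
      intro h
      apply hψ
      have h2 := ((hT (-c) (((fun z : E4 ↦ c + z) ∘ ψ) y)).mdifferentiableAt).comp y h
      have heq : (fun z : E4 ↦ -c + z) ∘ ((fun z : E4 ↦ c + z) ∘ ψ) = ψ :=
        funext fun z ↦ neg_add_cancel_left c (ψ z)
      rwa [heq] at h2
    rw [mfderiv_zero_of_not_mdifferentiableAt hψ, mfderiv_zero_of_not_mdifferentiableAt hψ']
    rfl

/-- **Translations are isometries of Minkowski space, at the level of chart components**: the
components of `(T_c ∘ ψ)^* η` and of `ψ^* η` agree identically, for every `ψ : E4 → ℝ⁴₁`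
(`η` has constant components and `d(T_c ∘ ψ) = dψ`). O'Neill 1983, Ch. 9, Prop. 9.8 (the
isometries of `ℝⁿ_ν` are the maps `x ↦ Ax + c`). [cite: ONeillSemiRiemannian1983, Ch. 3  p. 55] -/
theorem metricInCoords_minkowski_translate_comp (c : E4) (ψ : E4 → E4) :
    Minkowski.spacetime.metricInCoords ((fun z : E4 ↦ c + z) ∘ ψ) =
      Minkowski.spacetime.metricInCoords ψ := by
  funext y
  ext v w
  change Minkowski.bilin (mfderiv 𝓘(ℝ, E4) 𝓘(ℝ, E4) ((fun z : E4 ↦ c + z) ∘ ψ) y v)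
      (mfderiv 𝓘(ℝ, E4) 𝓘(ℝ, E4) ((fun z : E4 ↦ c + z) ∘ ψ) y w) =
    Minkowski.bilin (mfderiv 𝓘(ℝ, E4) 𝓘(ℝ, E4) ψ y v) (mfderiv 𝓘(ℝ, E4) 𝓘(ℝ, E4) ψ y w)
  rw [mfderiv_translate_comp]
  rfl

/-- The translated inclusion `y ↦ c + y` of the far cylinder `Kerr.region 0 R` into Minkowski
spacetime has vanishing deviation from the far background `g_{0,0} = η`. [folklore] -/
theorem deviation_minkowski_translate_farChart (R : ℝ) (c : E4) (x : Kerr.region (0 : ℝ) R) :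
    Minkowski.spacetime.deviation (farBackground 0 R)
      (fun y : Kerr.region (0 : ℝ) R ↦ c + (y : E4)) x = 0 := by
  ext v w
  change Minkowski.bilin (mfderiv 𝓘(ℝ, E4) (𝓡 4) (fun y : Kerr.region (0 : ℝ) R ↦ c + (y : E4)) x v)
      (mfderiv 𝓘(ℝ, E4) (𝓡 4) (fun y : Kerr.region (0 : ℝ) R ↦ c + (y : E4)) x w) -
    Kerr.bilin 0 0 x v w = 0
  rw [mfderiv_translate_subtypeVal_apply, mfderiv_translate_subtypeVal_apply,
    Kerr.bilin_zero_left, sub_self]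

/-- Hence its extended far deviation vanishes identically. [folklore] -/
theorem deviationExtend_minkowski_translate_farChart (R : ℝ) (c : E4) :
    Minkowski.spacetime.deviationExtend (farBackground 0 R)
      (fun y : Kerr.region (0 : ℝ) R ↦ c + (y : E4)) = 0 := by
  funext y
  by_cases hy : y ∈ Kerr.region (0 : ℝ) R
  · have := Minkowski.spacetime.deviationExtend_coe (farBackground 0 R)
      (fun y : Kerr.region (0 : ℝ) R ↦ c + (y : E4)) ⟨y, hy⟩
    rw [deviation_minkowski_translate_farChart] at this
    exact this
  · have h : ¬ ∃ a : Kerr.region (0 : ℝ) R, (a : E4) = y := fun ⟨a, ha⟩ ↦ hy (ha ▸ a.2)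
    exact Function.extend_apply' _ _ _ h

/-- **Every sequence of pointed Minkowski spaces `(ℝ⁴₁, pₙ)` converges (with far charts) to
`(ℝ⁴₁, 0)`**, in `Cᵏ_loc` for every `k`: the comparison maps are the TRANSLATIONS `y ↦ pₙ + y`
(global isometries preserving `∂ₜ`, along the whole sequence, `sub = id`), the far charts of the
members are the translated cylinder inclusions `y ↦ pₙ + y`, that of the limit the inclusion of
`ℝ_t × {|x| > R}`; all deviations vanish identically.  (A `LocalSubconvergence` datum built from
a sequence of global isometries; Petersen 2006, Ch. 10 §3.2.) [cite: Petersen2006, Ch. 10 §3.2] -/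
theorem subconvergesLocallyWithFarChartsTo_minkowski_translate (p : ℕ → E4) (k : ℕ) (R : ℝ) :
    Spacetime.SubconvergesLocallyWithFarChartsTo (fun _ ↦ Minkowski.spacetime) p
      Minkowski.spacetime (0 : E4) k (farBackground 0 R)
      (fun n (y : Kerr.region (0 : ℝ) R) ↦ p n + (y : E4)) Subtype.val := by
  have hT : ∀ (a z : E4), HasMFDerivAt 𝓘(ℝ, E4) 𝓘(ℝ, E4) (fun z : E4 ↦ a + z) z
      (ContinuousLinearMap.id ℝ E4) := fun a z ↦ ((hasFDerivAt_id z).const_add a).hasMFDerivAt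
  have hdiff : ∀ a : E4, IsLocalDiffeomorph 𝓘(ℝ, E4) 𝓘(ℝ, E4) ∞ (fun z : E4 ↦ a + z) := fun a ↦
    ({ toEquiv := Equiv.addLeft a
       contMDiff_toFun := contMDiff_iff_contDiff.mpr (contDiff_const.add contDiff_id)
       contMDiff_invFun := contMDiff_iff_contDiff.mpr (contDiff_const.add contDiff_id) } :
      Diffeomorph 𝓘(ℝ, E4) 𝓘(ℝ, E4) E4 E4 ∞).isLocalDiffeomorph
  refine ⟨{ sub := id
            strictMono_sub := strictMono_id
            U := (Spacetime.LocalSubconvergence.refl Minkowski.spacetime (0 : E4) k).U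
            monotone_U := (Spacetime.LocalSubconvergence.refl Minkowski.spacetime (0 : E4) k).monotone_U
            mem_U := (Spacetime.LocalSubconvergence.refl Minkowski.spacetime (0 : E4) k).mem_U
            iUnion_U := (Spacetime.LocalSubconvergence.refl Minkowski.spacetime (0 : E4) k).iUnion_U
            isCompact_closure_U :=
              (Spacetime.LocalSubconvergence.refl Minkowski.spacetime (0 : E4) k).isCompact_closure_U
            embed := fun n (y : E4) ↦ p n + y
            isLocalDiffeomorphOn_embed := fun n ↦ (hdiff (p n)).isLocalDiffeomorphOn _
            injOn_embed := fun n ↦ (add_right_injective (p n)).injOn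
            embed_basepoint := fun n ↦ add_zero (p n)
            isFutureDirected_mfderiv_embed := fun n x _ ↦ ?_
            tendsto_supCkENorm := fun x K _ _ ↦ ?_ }, ?_, ?_⟩
  · show Minkowski.spacetime.timeOrientation.IsFutureDirected
      (mfderiv 𝓘(ℝ, E4) 𝓘(ℝ, E4) (fun z : E4 ↦ p n + z) x (E4.basisVector 0))
    rw [(hT (p n) x).mfderiv]
    exact Minkowski.spacetime.timeOrientation.isFutureDirected_vectorField _
  · show Tendsto (fun n ↦ supCkENorm K k (Minkowski.spacetime.metricInCoords
        ((fun z : E4 ↦ p n + z) ∘ (chartAt E4 x).symm) -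
      Minkowski.spacetime.metricInCoords (chartAt E4 x).symm)) atTop (𝓝 0)
    have h0 : ∀ n, Minkowski.spacetime.metricInCoords ((fun z : E4 ↦ p n + z) ∘ (chartAt E4 x).symm) -
        Minkowski.spacetime.metricInCoords (chartAt E4 x).symm = 0 := fun n ↦ by
      rw [metricInCoords_minkowski_translate_comp]
      exact sub_self (Minkowski.spacetime.metricInCoords (chartAt E4 x).symm)
    simp only [h0, supCkENorm_zero]
    exact tendsto_const_nhds
  · exact fun _ _ _ ↦ Eventually.of_forall fun _ _ _ ↦ rfl
  · intro K _ _
    show Tendsto (fun n ↦ supCkENorm K k (Minkowski.spacetime.deviationExtend (farBackground 0 R)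
        (fun y : Kerr.region (0 : ℝ) R ↦ p n + (y : E4)) -
      Minkowski.spacetime.deviationExtend (farBackground 0 R)
        (Subtype.val : Kerr.region (0 : ℝ) R → E4))) atTop (𝓝 0)
    have h0 : ∀ n, Minkowski.spacetime.deviationExtend (farBackground 0 R)
        (fun y : Kerr.region (0 : ℝ) R ↦ p n + (y : E4)) -
      Minkowski.spacetime.deviationExtend (farBackground 0 R)
        (Subtype.val : Kerr.region (0 : ℝ) R → E4) = 0 := fun n ↦ by
      rw [deviationExtend_minkowski_translate_farChart, deviationExtend_minkowski_farChart]
      exact sub_self (0 : E4 → E4 →L[ℝ] E4 →L[ℝ] ℝ)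
    simp only [h0, supCkENorm_zero]
    exact tendsto_const_nhds

end MinkowskiTranslates

/-! ## §4 S7 at the model point: on the Minkowski development of `(ℝ³, δ, 0)` the antecedent of
`stub_tameEndgame` is satisfiable and its consequent holds -/

section MinkowskiModel

open Summit.FinalStateConjecture.FinalStateConjecture.Theorems.UniversalWitnessFamily.Negative
  (settledIn_minkowski)

/-- **Minkowski space is flat** in the sense of `TameEternalLimit.IsFlat` (the Levi-Civita
connection of `η` has vanishing curvature). [cite: ONeillSemiRiemannian1983, Ch. 3, remark after Prop. 3.41 (p. 80)] -/
theorem isFlat_leviCivita_minkowski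
    [Minkowski.smoothMetric.toPseudoRiemannianMetric.HasLeviCivita] :
    Minkowski.smoothMetric.toPseudoRiemannianMetric.leviCivita.IsFlat :=
  Minkowski.smoothMetric.toPseudoRiemannianMetric.isFlat_leviCivita_of_val_eq_const
    Minkowski.bilin (fun _ ↦ rfl) (by decide)

/-- **S7 at the model point (registered sub-goal `stub_tameEndgameMinkowskiModel`).**  On the
vacuum Cauchy development `Minkowski.vacuumCauchyDevelopment` of the trivial datum `(ℝ³, δ, 0)`:
(1) the ANTECEDENT of `stub_tameEndgame` is satisfiable in the strongest form — along EVERY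
sequence of base points `p` (escaping or not, outer or not) the Minkowski tame eternal limit
(`M = 0`, far chart the inclusion of `ℝ_t × {|x| > 1}`, empty horizon) arises from the
development, through the translations `y ↦ pₙ + y`
(`subconvergesLocallyWithFarChartsTo_minkowski_translate`), and it is FLAT; (2) the CONSEQUENT
holds — the honest exhaustive `N = 0` decomposition of the self-determined exterior
`{x⁰ ≥ 0} = J⁺(ι ℝ³) ∩ I⁻(charted)` by the identity flat chart (the tree's
`UniversalWitnessFamily.Negative.settledIn_minkowski`).  So at the one development the tree can
build, S7 is true with both sides inhabited (neither vacuous by antecedent nor cheap by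
consequent). [cite: ChristodoulouKlainerman1993, Thm. 1.0.2] -/
theorem stub_tameEndgameMinkowskiModel :
    (∀ p : ℕ → Minkowski.vacuumCauchyDevelopment.carrier, ∃ E : TameEternalLimit,
        E.ArisesFrom Minkowski.vacuumCauchyDevelopment p ∧
          ∀ [E.Z.metric.toPseudoRiemannianMetric.HasLeviCivita], E.IsKerrBlackHole ∨ E.IsFlat) ∧
      ∃ (O : Set Minkowski.vacuumCauchyDevelopment.carrier)
        (d : Literature.Geometry.Lorentzian.FinalStateDecomposition
          Minkowski.vacuumCauchyDevelopment.toSpacetime O 2),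
        O = _root_.Summit.FinalStateConjecture.exteriorOf
            Minkowski.vacuumCauchyDevelopment.toCauchyDevelopment d.charted ∧
          _root_.Summit.FinalStateConjecture.HasExhaustiveCharts d := by
  refine ⟨fun p ↦ ?_, ?_⟩
  · refine ⟨
      { Z := Minkowski.spacetime
        z := (0 : E4)
        M := 0
        R := 1
        Φ := Subtype.val
        t := fun x : E4 ↦ x 0
        L := fun _ ↦ 0
        mass_nonneg := le_rfl
        lt_R := by norm_num
        isRicciFlat := by
          intro hLC
          haveI : Minkowski.smoothMetric.toPseudoRiemannianMetric.HasLeviCivita := hLC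
          exact Minkowski.isRicciFlat_holds
        isGloballyHyperbolic := Minkowski.isGloballyHyperbolic
        subset_chronologicalFuture := by
          change (univ : Set E4) ⊆ (LorentzianMetric.ofLE (n' := (∞ : ℕ∞ω)) Minkowski.metric le_top).chronologicalFuture
            (TimeOrientation.ofLE (n' := (∞ : ℕ∞ω)) Minkowski.timeOrientation le_top)
            (Set.range (Subtype.val : Kerr.region (0 : ℝ) 1 → E4))
          rw [chronologicalFuture_farCylinder_eq_univ]
        isLocalDiffeomorph_far := isLocalDiffeomorph_subtypeVal_minkowski _
        injective_far := Subtype.val_injective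
        far_bounds k := ⟨0, fun m _ x ↦ by
          rw [deviationExtend_minkowski_farChart, iteratedFDeriv_zero (𝕜 := ℝ)]
          simp⟩
        far_nonradiating m δ hδ := ⟨0, fun x _ ↦ by
          have h0 : (fun y : E4 ↦ fderiv ℝ (Minkowski.spacetime.deviationExtend (farBackground 0 1)
              (Subtype.val : Kerr.region (0 : ℝ) 1 → E4)) y (Literature.Geometry.Lorentzian.E4.basisVector 0)) = 0 := by
            funext y
            rw [deviationExtend_minkowski_farChart]
            simp
          rw [h0, iteratedFDeriv_zero (𝕜 := ℝ)]
          simpa using hδ.le⟩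
        far_clock _ := rfl
        contMDiff_clock := contMDiff_iff_contDiff.mpr (contDiff_piLp_apply (p := 2))
        tame k := ⟨1, one_pos, 0, fun q _ ↦ tameClockChartAt_minkowski k one_pos 0 q⟩
        basepoint_mem := by
          change (0 : E4) ∈ closure (Minkowski.spacetime.docOfEnd
            (Set.range (Subtype.val : Kerr.region (0 : ℝ) 1 → E4)))
          rw [docOfEnd_farCylinder_eq_univ, closure_univ]
          exact mem_univ _
        contMDiffOn_generator := ⟨∅, isOpen_empty, by rw [futureEventHorizonOfEnd_farCylinder_eq_empty],
          fun _ h ↦ h.elim⟩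
        generator_null p hp := by
          rw [futureEventHorizonOfEnd_farCylinder_eq_empty] at hp
          exact hp.elim
        generator_tangent γ _ h0 := by
          rw [futureEventHorizonOfEnd_farCylinder_eq_empty] at h0
          exact h0.elim
        generator_complete p hp := by
          rw [futureEventHorizonOfEnd_farCylinder_eq_empty] at hp
          exact hp.elim
        horizon_regular := by
          refine ⟨∅, fun _ ↦ 0, isOpen_empty, ?_, fun _ h ↦ h.elim, ?_, ?_⟩
          · rw [futureEventHorizonOfEnd_farCylinder_eq_empty]
          · rw [futureEventHorizonOfEnd_farCylinder_eq_empty]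
            ext p
            simp
          · intro p hp
            rw [futureEventHorizonOfEnd_farCylinder_eq_empty] at hp
            exact hp.elim
        isCompact_horizonSlice c := by
          rw [futureEventHorizonOfEnd_farCylinder_eq_empty, empty_inter]
          exact isCompact_empty
        nonexpanding := by
          intro _ p hp
          rw [futureEventHorizonOfEnd_farCylinder_eq_empty] at hp
          exact hp.elim }, ?_, ?_⟩
    · exact ⟨_, subconvergesLocallyWithFarChartsTo_minkowski_translate p 2 1⟩
    · intro hLC
      haveI : Minkowski.smoothMetric.toPseudoRiemannianMetric.HasLeviCivita := hLC
      exact Or.inr isFlat_leviCivita_minkowski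
  · obtain ⟨-, O, d, -, hO, hd⟩ := settledIn_minkowski
    exact ⟨O, d, hO, hd⟩

end MinkowskiModel

end Summit.FinalStateConjecture.FinalStateConjecture.Theorems.TrappedSet

end
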